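import Summits.PneNP.PneNP.Theorems.ChebyshevTracialDesignSwapSymmetry
import Summits.PneNP.PneNP.Theorems.ChebyshevTracialDesignTypeAveraging
import Summits.PneNP.PneNP.Theorems.ChebyshevTracialDesignPairContainmentEntrywise
import HarnessLib

/-!
# Cell pnp-psdrank, route `ChebyshevTracialDesign`: (CG_1′) for `H`-symmetric masks in ALL directions — the per-matching reduction to a
# type-constant direction plus the diagonal excess, and the `M`-sum of the excess via the `r = 1` rung — brick 145d (crux `TracialDecayExp20`,
# stmt-PneNP-19878)

Brick 145d (prover g29; MEMO-32 §3). For a matching `M` (partner `π`), a block `H`, a weight `W = levelWeight n t C w` (`t` odd), an `H`-symmetric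
mask `ψ(|U∩H|)` and a PAIR-SYMMETRIC direction `c : [n] → [−1,1]` (`c(πp) = c(p)`), the containment form is `C_c(U) = Σ_p c(p)·x_px_{πp}` and
`Q_M(c) = Σ_U W(U,M)ψ(|U∩H|)C_c(U)² = Σ_{p,q} c_pc_q A_M(p,q)` with the pair kernel `A_M(p,q) = Σ_U W(U,M)ψ(|U∩H|)x_px_{πp}x_qx_{πq}`. By swap
symmetry (brick 145a) `A_M` is block-symmetric for the edge type `τ(p) = [p∈H] + [πp∈H]`, so the type-averaging reduction (brick 145b) applies:
* §1 `containment_eq_pairKernel` (the expansion), **`containment_le_typeAvg_add_excess`**: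
  `Q_M(c) ≤ Q_M(v) + 8·Σ_p Σ_{q∉{p,πp}} (A_M(p,p) − A_M(p,q))₊` with `v` the type average of `c` (type-constant, `|v| ≤ 1`);
* §2 **`sum_excess_le`**: `Σ_M Σ_p Σ_{q∉{p,πp}} (A_M(p,p) − A_M(p,q))₊ ≤ G·n⁶·γ` whenever every rectangle has `W`-mass `≤ γ` and `0 ≤ ψ ≤ G`:
  `A_M(p,p) − A_M(p,q)` is the design value of the nonnegative FIXED cut function `ψ·x_px_{πp}(1 − x_qx_{q′})` against `1[π_Mq = q′]`, so brick 102 §2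
  (`sum_posPart_pairPinned_le`, i.e. the `r = 1` rung entrywise) prices it — no analytic input.
The final all-directions theorem (the `M`-average with bricks 145c and the `r = 1` rung) is the next file. WHAT THIS FILE DOES NOT DO: that assembly;
anything on `TracialDecayExp20` itself, psd rank of P_PM(K_n), or P vs NP. [cite: Rothvoss2017, §2 and Lemma 7 (PDF pp. 5–8)]
[cite: KeevashLifshitz2023, Thm. 1.8] [cite: GriblingDelaatLaurent2019, §5]
Stature: support/instrument (kernel lane, no defs, axioms standard). Supports stmt-PneNP-19878.
-/

set_option linter.dupNamespace false -- `Summit.PneNP.PneNP.…`: summit = sub-problem (D-0017)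

noncomputable section

namespace Summit.PneNP.PneNP.Theorems.ChebyshevTracialDesignAllDirectionsReduction

open Finset Literature.Barriers.PneNP Literature.Combinatorics.Optimization
open Literature.Combinatorics.Optimization.ShellStep
open Summit.PneNP.PneNP.Theorems.ChebyshevTracialDesignSwapSymmetry (pairKernel_perm_eq type_perm_eq exists_admissible_swap)
open Summit.PneNP.PneNP.Theorems.ChebyshevTracialDesignTypeAveraging (quadForm_le_typeAvg_add_excess)
open Summit.PneNP.PneNP.Theorems.ChebyshevTracialDesignPairContainmentEntrywise (sum_posPart_pairPinned_le)

variable {n : ℕ}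

/-! ### §1 The per-matching reduction -/

/-- **Expansion**: `Σ_U W(U,M)ψ(|U∩H|)(Σ_p c_p x_px_{πp})² = Σ_{p,q} c_pc_q·A_M(p,q)`. [cite: Rothvoss2017, §2 (PDF p. 6)] -/
theorem containment_eq_pairKernel (W : OddSet n → PMatch n → ℝ) (M : PMatch n) (f : OddSet n → ℝ) (c : Fin n → ℝ) :
    ∑ U : OddSet n, W U M * (f U *
        (∑ p : Fin n, c p * ((if p ∈ U.1 then (1 : ℝ) else 0) * (if M.2.partner p ∈ U.1 then (1 : ℝ) else 0))) ^ 2) =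
      ∑ p : Fin n, ∑ q : Fin n, c p * c q * ∑ U : OddSet n, W U M * (f U *
        (((if p ∈ U.1 then (1 : ℝ) else 0) * (if M.2.partner p ∈ U.1 then (1 : ℝ) else 0)) *
          ((if q ∈ U.1 then (1 : ℝ) else 0) * (if M.2.partner q ∈ U.1 then (1 : ℝ) else 0)))) := by
  have hsq : ∀ U : OddSet n, W U M * (f U *
      (∑ p : Fin n, c p * ((if p ∈ U.1 then (1 : ℝ) else 0) * (if M.2.partner p ∈ U.1 then (1 : ℝ) else 0))) ^ 2) =
      ∑ p : Fin n, ∑ q : Fin n, c p * c q * (W U M * (f U *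
        (((if p ∈ U.1 then (1 : ℝ) else 0) * (if M.2.partner p ∈ U.1 then (1 : ℝ) else 0)) *
          ((if q ∈ U.1 then (1 : ℝ) else 0) * (if M.2.partner q ∈ U.1 then (1 : ℝ) else 0))))) := by
    intro U
    rw [sq, sum_mul_sum, mul_sum, mul_sum]
    refine sum_congr rfl fun p _ => ?_
    rw [mul_sum, mul_sum]
    refine sum_congr rfl fun q _ => ?_
    ring
  rw [Fintype.sum_congr _ _ hsq, sum_comm]
  refine sum_congr rfl fun p _ => ?_
  rw [sum_comm]
  refine sum_congr rfl fun q _ => ?_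
  rw [mul_sum]

/-- Bookkeeping of edge types: equal counts and aligned first endpoints give aligned second endpoints. [folklore] -/
theorem iff_of_count_eq {a b c d : Prop} [Decidable a] [Decidable b] [Decidable c] [Decidable d]
    (h : ((if a then 1 else 0) + (if b then 1 else 0) : ℕ) = (if c then 1 else 0) + (if d then 1 else 0)) (hac : a ↔ c) :
    b ↔ d := by
  by_cases ha : a <;> by_cases hb : b <;> by_cases hc : c <;> by_cases hd : d <;> simp_all

/-- Bookkeeping of edge types: equal counts and anti-aligned first endpoints give the crossed alignment. [folklore] -/
theorem iff_of_count_eq' {a b c d : Prop} [Decidable a] [Decidable b] [Decidable c] [Decidable d]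
    (h : ((if a then 1 else 0) + (if b then 1 else 0) : ℕ) = (if c then 1 else 0) + (if d then 1 else 0)) (hac : ¬ (a ↔ c)) :
    (a ↔ d) ∧ (b ↔ c) := by
  by_cases ha : a <;> by_cases hb : b <;> by_cases hc : c <;> by_cases hd : d <;> simp_all

/-- **THE PER-MATCHING REDUCTION (brick 145d §1).** For `t` odd, a matching `M`, a block `H`, a mask `ψ`, a pair-symmetric direction
`c : [n] → [−1,1]` and its type average `v` (for the edge type `τ(p) = [p∈H] + [πp∈H]`):
`Σ_U W(U,M)ψ(|U∩H|)C_c(U)² ≤ Σ_U W(U,M)ψ(|U∩H|)C_v(U)² + 8·Σ_p Σ_{q∉{p,πp}} (A_M(p,p) − A_M(p,q))₊`.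
[cite: Rothvoss2017, §2 (PDF pp. 5–6)] -/
theorem containment_le_typeAvg_add_excess {t : ℕ} (ht : Odd t) (C : Finset ℕ) (w : ℕ → ℝ) (M : PMatch n) (H : Finset (Fin n))
    (ψ : ℤ → ℝ) (τ : Fin n → Fin 3) (hτ : ∀ p, ((τ p : ℕ)) = (if p ∈ H then 1 else 0) + (if M.2.partner p ∈ H then 1 else 0))
    (c : Fin n → ℝ) (hcπ : ∀ p, c (M.2.partner p) = c p) (hc : ∀ p, |c p| ≤ 1) (v : Fin n → ℝ)
    (hv : ∀ p, v p = (∑ q ∈ univ.filter (fun q => τ q = τ p), c q) / ((univ.filter fun q => τ q = τ p).card : ℝ)) :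
    ∑ U : OddSet n, levelWeight n t C w U M * (ψ ((U.1 ∩ H).card : ℤ) *
        (∑ p : Fin n, c p * ((if p ∈ U.1 then (1 : ℝ) else 0) * (if M.2.partner p ∈ U.1 then (1 : ℝ) else 0))) ^ 2) ≤
      ∑ U : OddSet n, levelWeight n t C w U M * (ψ ((U.1 ∩ H).card : ℤ) *
        (∑ p : Fin n, v p * ((if p ∈ U.1 then (1 : ℝ) else 0) * (if M.2.partner p ∈ U.1 then (1 : ℝ) else 0))) ^ 2) +
      8 * ∑ p : Fin n, ∑ q ∈ univ.filter (fun q => q ≠ p ∧ q ≠ M.2.partner p),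
        max (∑ U : OddSet n, levelWeight n t C w U M * (ψ ((U.1 ∩ H).card : ℤ) *
            (((if p ∈ U.1 then (1 : ℝ) else 0) * (if M.2.partner p ∈ U.1 then (1 : ℝ) else 0)) *
              ((if p ∈ U.1 then (1 : ℝ) else 0) * (if M.2.partner p ∈ U.1 then (1 : ℝ) else 0)))) -
          ∑ U : OddSet n, levelWeight n t C w U M * (ψ ((U.1 ∩ H).card : ℤ) *
            (((if p ∈ U.1 then (1 : ℝ) else 0) * (if M.2.partner p ∈ U.1 then (1 : ℝ) else 0)) *
              ((if q ∈ U.1 then (1 : ℝ) else 0) * (if M.2.partner q ∈ U.1 then (1 : ℝ) else 0))))) 0 := by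
  classical
  have hπ : ∀ v, M.2.partner (M.2.partner v) = v := partner_partner M
  have hπ' : ∀ v, M.2.partner v ≠ v := partner_ne M
  -- the pair kernel
  obtain ⟨A, hA⟩ : ∃ A : Fin n → Fin n → ℝ, ∀ p q, A p q = ∑ U : OddSet n, levelWeight n t C w U M * (ψ ((U.1 ∩ H).card : ℤ) *
      (((if p ∈ U.1 then (1 : ℝ) else 0) * (if M.2.partner p ∈ U.1 then (1 : ℝ) else 0)) *
        ((if q ∈ U.1 then (1 : ℝ) else 0) * (if M.2.partner q ∈ U.1 then (1 : ℝ) else 0)))) := ⟨_, fun _ _ => rfl⟩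
  -- the hypotheses of the type-averaging reduction
  have hτπ : ∀ p, τ (M.2.partner p) = τ p := fun p => by
    apply Fin.ext; rw [hτ, hτ, hπ]; ring
  have hAs : ∀ p q, A p q = A q p := fun p q => by
    rw [hA, hA]; refine Fintype.sum_congr _ _ fun U => ?_; ring
  have hAπ : ∀ p q, A p (M.2.partner q) = A p q := fun p q => by
    rw [hA, hA]; refine Fintype.sum_congr _ _ fun U => ?_; rw [hπ]; ring
  -- the invariance under admissible permutations (brick 145a)
  have hinv : ∀ g : Equiv.Perm (Fin n), (∀ i, g (M.2.partner i) = M.2.partner (g i)) → (∀ i, g i ∈ H ↔ i ∈ H) →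
      ∀ p q, A (g p) (g q) = A p q := fun g hgπ hgH p q => by
    rw [hA, hA]; exact pairKernel_perm_eq ht C w M H ψ g hgπ hgH p q
  have hτinv : ∀ g : Equiv.Perm (Fin n), (∀ i, g (M.2.partner i) = M.2.partner (g i)) → (∀ i, g i ∈ H ↔ i ∈ H) →
      ∀ q, τ (g q) = τ q := fun g hgπ hgH q => by
    apply Fin.ext; rw [hτ, hτ]; exact type_perm_eq M H g hgπ hgH q
  -- from `τ q = τ q'`: an admissible `g` with `g q ∈ {q', πq'}` fixing everything outside the two edges
  have hswap : ∀ q q' : Fin n, τ q = τ q' → q' ≠ q → q' ≠ M.2.partner q →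
      ∃ g : Equiv.Perm (Fin n), (∀ i, g (M.2.partner i) = M.2.partner (g i)) ∧ (∀ i, g i ∈ H ↔ i ∈ H) ∧
        (g q = q' ∨ g q = M.2.partner q') ∧
        ∀ x, x ≠ q → x ≠ M.2.partner q → x ≠ q' → x ≠ M.2.partner q' → g x = x := by
    intro q q' hqq' h1 h2
    have hcount : ((if q ∈ H then 1 else 0) + (if M.2.partner q ∈ H then 1 else 0) : ℕ) =
        (if q' ∈ H then 1 else 0) + (if M.2.partner q' ∈ H then 1 else 0) := by rw [← hτ, ← hτ, hqq']
    by_cases hal : (q ∈ H ↔ q' ∈ H)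
    · have hal' : (M.2.partner q ∈ H ↔ M.2.partner q' ∈ H) := iff_of_count_eq hcount hal
      obtain ⟨g, hg1, hg2, hg3, hg4⟩ := exists_admissible_swap M H h1 h2 hal hal'
      exact ⟨g, hg1, hg2, Or.inl hg3, fun x hx1 hx2 hx3 hx4 => hg4 x hx1 hx3 hx2 hx4⟩
    · have hal2 : (q ∈ H ↔ M.2.partner q' ∈ H) := (iff_of_count_eq' hcount hal).1
      have hal2' : (M.2.partner q ∈ H ↔ M.2.partner (M.2.partner q') ∈ H) := by
        rw [hπ]; exact (iff_of_count_eq' hcount hal).2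
      have h1' : M.2.partner q' ≠ q := fun h => h2 (by rw [← h, hπ])
      have h2' : M.2.partner q' ≠ M.2.partner q := fun h => h1 (by rw [← hπ q', h, hπ])
      obtain ⟨g, hg1, hg2, hg3, hg4⟩ := exists_admissible_swap M H h1' h2' hal2 hal2'
      refine ⟨g, hg1, hg2, Or.inr hg3, fun x hx1 hx2 hx3 hx4 => hg4 x hx1 hx4 hx2 (by rw [hπ]; exact hx3)⟩
  -- ROW fact
  have hrow : ∀ p q q', q ≠ p → q ≠ M.2.partner p → q' ≠ p → q' ≠ M.2.partner p → τ q = τ q' → A p q = A p q' := by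
    intro p q q' hqp hqπ hq'p hq'π hqq'
    by_cases e1 : q' = q
    · rw [e1]
    by_cases e2 : q' = M.2.partner q
    · rw [e2, hAπ]
    obtain ⟨g, hg1, hg2, hg3, hg4⟩ := hswap q q' hqq' e1 e2
    have hp1 : p ≠ M.2.partner q := fun h => hqπ (by rw [h, hπ])
    have hp2 : p ≠ M.2.partner q' := fun h => hq'π (by rw [h, hπ])
    have hgp : g p = p := hg4 p (Ne.symm hqp) hp1 (Ne.symm hq'p) hp2
    have key := hinv g hg1 hg2 p q
    rw [hgp] at key
    rcases hg3 with h | h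
    · rw [← key, h]
    · rw [← key, h, hAπ]
  -- BLOCK fact
  have hB : ∀ p p', τ p = τ p' → ∀ k,
      ∑ q ∈ univ.filter (fun q => τ q = k), A p q = ∑ q ∈ univ.filter (fun q => τ q = k), A p' q := by
    intro p p' hpp' k
    have hreidx : ∀ g : Equiv.Perm (Fin n), (∀ i, g (M.2.partner i) = M.2.partner (g i)) → (∀ i, g i ∈ H ↔ i ∈ H) →
        ∀ r : Fin n, ∑ q ∈ univ.filter (fun q => τ q = k), A r (g q) = ∑ q ∈ univ.filter (fun q => τ q = k), A r q := by
      intro g hgπ hgH r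
      rw [sum_filter, sum_filter]
      have h := Equiv.sum_comp g (fun q => if τ q = k then A r q else 0)
      simp only [hτinv g hgπ hgH] at h
      exact h
    by_cases e1 : p' = p
    · rw [e1]
    by_cases e2 : p' = M.2.partner p
    · refine sum_congr rfl fun q _ => ?_
      rw [e2, hAs (M.2.partner p) q, hAπ q p, hAs p q]
    obtain ⟨g, hg1, hg2, hg3, hg4⟩ := hswap p p' hpp' e1 e2
    rcases hg3 with h | h
    · rw [← hreidx g hg1 hg2 p', ← h]
      exact sum_congr rfl fun q _ => (hinv g hg1 hg2 p q).symm
    · rw [← hreidx g hg1 hg2 p']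
      refine sum_congr rfl fun q _ => ?_
      rw [← hinv g hg1 hg2 p q, h, hAs (M.2.partner p') (g q), hAπ (g q) p', hAs (g q) p']
  have key := quadForm_le_typeAvg_add_excess M.2.partner hπ' τ hτπ A hAs hAπ hrow hB c hcπ hc v hv
  simp only [hA] at key
  rw [containment_eq_pairKernel, containment_eq_pairKernel]
  exact key

/-! ### §2 The excess, summed over the matchings -/

/-- **The diagonal excess is priced by the `r = 1` rung, entrywise.** If every rectangle has `W`-mass `≤ γ` and `0 ≤ ψ ≤ G` (`G > 0`), then
`Σ_M Σ_p Σ_{q∉{p,πp}} (A_M(p,p) − A_M(p,q))₊ ≤ G·n⁶·γ`. [cite: Rothvoss2017, §2 and Lemma 7 (PDF pp. 6–8)] [cite: KeevashLifshitz2023, Thm. 1.8] -/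
theorem sum_excess_le (W : OddSet n → PMatch n → ℝ) {γ : ℝ}
    (hR : ∀ (A : Finset (OddSet n)) (B : Finset (PMatch n)), ∑ U ∈ A, ∑ M ∈ B, W U M ≤ γ)
    (H : Finset (Fin n)) (ψ : ℤ → ℝ) {G : ℝ} (hG : 0 < G) (hψ0 : ∀ x, 0 ≤ ψ x) (hψG : ∀ x, ψ x ≤ G) :
    ∑ M : PMatch n, ∑ p : Fin n, ∑ q ∈ univ.filter (fun q => q ≠ p ∧ q ≠ M.2.partner p),
        max (∑ U : OddSet n, W U M * (ψ ((U.1 ∩ H).card : ℤ) *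
            (((if p ∈ U.1 then (1 : ℝ) else 0) * (if M.2.partner p ∈ U.1 then (1 : ℝ) else 0)) *
              ((if p ∈ U.1 then (1 : ℝ) else 0) * (if M.2.partner p ∈ U.1 then (1 : ℝ) else 0)))) -
          ∑ U : OddSet n, W U M * (ψ ((U.1 ∩ H).card : ℤ) *
            (((if p ∈ U.1 then (1 : ℝ) else 0) * (if M.2.partner p ∈ U.1 then (1 : ℝ) else 0)) *
              ((if q ∈ U.1 then (1 : ℝ) else 0) * (if M.2.partner q ∈ U.1 then (1 : ℝ) else 0))))) 0 ≤
      G * (n : ℝ) ^ 6 * γ := by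
  classical
  -- the fixed cut functions `f_{q q'} = ψ(|U∩H|)(1 − x_q x_{q'})/G ∈ [0,1]`
  set f : Fin n → Fin n → OddSet n → ℝ := fun q q' U =>
    ψ ((U.1 ∩ H).card : ℤ) * (1 - (if q ∈ U.1 then (1 : ℝ) else 0) * (if q' ∈ U.1 then (1 : ℝ) else 0)) / G with hf
  have hf01 : ∀ q q' U, 0 ≤ f q q' U ∧ f q q' U ≤ 1 := by
    intro q q' U
    rw [hf]; dsimp only
    have h1 := hψ0 ((U.1 ∩ H).card : ℤ); have h2 := hψG ((U.1 ∩ H).card : ℤ)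
    constructor
    · apply div_nonneg _ hG.le; apply mul_nonneg h1; split_ifs <;> norm_num
    · rw [div_le_one hG]
      have : (1 - (if q ∈ U.1 then (1 : ℝ) else 0) * (if q' ∈ U.1 then (1 : ℝ) else 0)) ≤ 1 := by split_ifs <;> norm_num
      have h0 : 0 ≤ (1 - (if q ∈ U.1 then (1 : ℝ) else 0) * (if q' ∈ U.1 then (1 : ℝ) else 0)) := by split_ifs <;> norm_num
      nlinarith
  -- each excess term as a `G`-multiple of an `f_{q,πq}`-cell
  have hterm : ∀ (M : PMatch n) (p q : Fin n),
      (∑ U : OddSet n, W U M * (ψ ((U.1 ∩ H).card : ℤ) *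
            (((if p ∈ U.1 then (1 : ℝ) else 0) * (if M.2.partner p ∈ U.1 then (1 : ℝ) else 0)) *
              ((if p ∈ U.1 then (1 : ℝ) else 0) * (if M.2.partner p ∈ U.1 then (1 : ℝ) else 0)))) -
          ∑ U : OddSet n, W U M * (ψ ((U.1 ∩ H).card : ℤ) *
            (((if p ∈ U.1 then (1 : ℝ) else 0) * (if M.2.partner p ∈ U.1 then (1 : ℝ) else 0)) *
              ((if q ∈ U.1 then (1 : ℝ) else 0) * (if M.2.partner q ∈ U.1 then (1 : ℝ) else 0))))) =
        G * ∑ U : OddSet n, W U M * (f q (M.2.partner q) U *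
            (((if p ∈ U.1 then (1 : ℝ) else 0) * (if M.2.partner p ∈ U.1 then (1 : ℝ) else 0)) *
              ((if p ∈ U.1 then (1 : ℝ) else 0) * (if M.2.partner p ∈ U.1 then (1 : ℝ) else 0)))) := by
    intro M p q
    rw [← sum_sub_distrib, mul_sum]
    refine Fintype.sum_congr _ _ fun U => ?_
    have hyp : ((if p ∈ U.1 then (1 : ℝ) else 0) * (if M.2.partner p ∈ U.1 then (1 : ℝ) else 0)) *
        ((if p ∈ U.1 then (1 : ℝ) else 0) * (if M.2.partner p ∈ U.1 then (1 : ℝ) else 0)) =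
        (if p ∈ U.1 then (1 : ℝ) else 0) * (if M.2.partner p ∈ U.1 then (1 : ℝ) else 0) := by
      split_ifs <;> norm_num
    rw [hyp, hf]; dsimp only
    field_simp
  -- reindex the partner of `q` as a free vertex `q'`
  have hmax : ∀ (M : PMatch n) (p q : Fin n),
      max (G * ∑ U : OddSet n, W U M * (f q (M.2.partner q) U *
            (((if p ∈ U.1 then (1 : ℝ) else 0) * (if M.2.partner p ∈ U.1 then (1 : ℝ) else 0)) *
              ((if p ∈ U.1 then (1 : ℝ) else 0) * (if M.2.partner p ∈ U.1 then (1 : ℝ) else 0))))) 0 ≤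
        ∑ q' : Fin n, G * max (∑ U : OddSet n, W U M * (f q q' U *
            (((if p ∈ U.1 then (1 : ℝ) else 0) * (if M.2.partner p ∈ U.1 then (1 : ℝ) else 0)) *
              ((if p ∈ U.1 then (1 : ℝ) else 0) * (if M.2.partner p ∈ U.1 then (1 : ℝ) else 0))))) 0 := by
    intro M p q
    have hnn : ∀ q', 0 ≤ G * max (∑ U : OddSet n, W U M * (f q q' U *
            (((if p ∈ U.1 then (1 : ℝ) else 0) * (if M.2.partner p ∈ U.1 then (1 : ℝ) else 0)) *
              ((if p ∈ U.1 then (1 : ℝ) else 0) * (if M.2.partner p ∈ U.1 then (1 : ℝ) else 0))))) 0 :=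
      fun q' => mul_nonneg hG.le (le_max_right _ _)
    refine le_trans ?_ (single_le_sum (fun q' _ => hnn q') (mem_univ (M.2.partner q)))
    rw [max_le_iff]
    exact ⟨mul_le_mul_of_nonneg_left (le_max_left _ _) hG.le, hnn _⟩
  calc _ = ∑ M : PMatch n, ∑ p : Fin n, ∑ q ∈ univ.filter (fun q => q ≠ p ∧ q ≠ M.2.partner p),
        max (G * ∑ U : OddSet n, W U M * (f q (M.2.partner q) U *
            (((if p ∈ U.1 then (1 : ℝ) else 0) * (if M.2.partner p ∈ U.1 then (1 : ℝ) else 0)) *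
              ((if p ∈ U.1 then (1 : ℝ) else 0) * (if M.2.partner p ∈ U.1 then (1 : ℝ) else 0))))) 0 := by
          refine sum_congr rfl fun M _ => sum_congr rfl fun p _ => sum_congr rfl fun q _ => ?_
          rw [hterm]
    _ ≤ ∑ M : PMatch n, ∑ p : Fin n, ∑ q : Fin n, ∑ q' : Fin n, G * max (∑ U : OddSet n, W U M * (f q q' U *
            (((if p ∈ U.1 then (1 : ℝ) else 0) * (if M.2.partner p ∈ U.1 then (1 : ℝ) else 0)) *
              ((if p ∈ U.1 then (1 : ℝ) else 0) * (if M.2.partner p ∈ U.1 then (1 : ℝ) else 0))))) 0 := by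
          refine sum_le_sum fun M _ => sum_le_sum fun p _ => ?_
          refine le_trans (sum_le_sum fun q _ => hmax M p q) ?_
          refine sum_le_sum_of_subset_of_nonneg (filter_subset _ _) fun q _ _ => sum_nonneg fun q' _ => ?_
          exact mul_nonneg hG.le (le_max_right _ _)
    _ = ∑ q : Fin n, ∑ q' : Fin n, ∑ M : PMatch n, ∑ p : Fin n, G * max (∑ U : OddSet n, W U M * (f q q' U *
            (((if p ∈ U.1 then (1 : ℝ) else 0) * (if M.2.partner p ∈ U.1 then (1 : ℝ) else 0)) *
              ((if p ∈ U.1 then (1 : ℝ) else 0) * (if M.2.partner p ∈ U.1 then (1 : ℝ) else 0))))) 0 := by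
          calc _ = ∑ M : PMatch n, ∑ q : Fin n, ∑ p : Fin n, ∑ q' : Fin n, G * max (∑ U : OddSet n, W U M * (f q q' U *
                    (((if p ∈ U.1 then (1 : ℝ) else 0) * (if M.2.partner p ∈ U.1 then (1 : ℝ) else 0)) *
                    ((if p ∈ U.1 then (1 : ℝ) else 0) * (if M.2.partner p ∈ U.1 then (1 : ℝ) else 0))))) 0 :=
                sum_congr rfl fun M _ => sum_comm
            _ = ∑ q : Fin n, ∑ M : PMatch n, ∑ p : Fin n, ∑ q' : Fin n, G * max (∑ U : OddSet n, W U M * (f q q' U *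
                    (((if p ∈ U.1 then (1 : ℝ) else 0) * (if M.2.partner p ∈ U.1 then (1 : ℝ) else 0)) *
                    ((if p ∈ U.1 then (1 : ℝ) else 0) * (if M.2.partner p ∈ U.1 then (1 : ℝ) else 0))))) 0 := sum_comm
            _ = ∑ q : Fin n, ∑ M : PMatch n, ∑ q' : Fin n, ∑ p : Fin n, G * max (∑ U : OddSet n, W U M * (f q q' U *
                    (((if p ∈ U.1 then (1 : ℝ) else 0) * (if M.2.partner p ∈ U.1 then (1 : ℝ) else 0)) *
                    ((if p ∈ U.1 then (1 : ℝ) else 0) * (if M.2.partner p ∈ U.1 then (1 : ℝ) else 0))))) 0 :=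
                sum_congr rfl fun q _ => sum_congr rfl fun M _ => sum_comm
            _ = _ := sum_congr rfl fun q _ => sum_comm
    _ ≤ ∑ _q : Fin n, ∑ _q' : Fin n, G * ((n : ℝ) ^ 4 * γ) := by
          refine sum_le_sum fun q _ => sum_le_sum fun q' _ => ?_
          simp only [← mul_sum]
          refine mul_le_mul_of_nonneg_left ?_ hG.le
          -- the diagonal terms of brick 102's entrywise bound for the mask `f_{q q'}`
          have h102 := sum_posPart_pairPinned_le W hR (f q q') (hf01 q q')
          refine le_trans (sum_le_sum fun M _ => sum_le_sum fun p _ => ?_) h102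
          exact single_le_sum (f := fun p₂ => max (∑ U : OddSet n, W U M * (f q q' U *
            (((if p ∈ U.1 then (1 : ℝ) else 0) * (if M.2.partner p ∈ U.1 then (1 : ℝ) else 0)) *
              ((if p₂ ∈ U.1 then (1 : ℝ) else 0) * (if M.2.partner p₂ ∈ U.1 then (1 : ℝ) else 0))))) 0)
            (fun _ _ => le_max_right _ _) (mem_univ p)
    _ = G * (n : ℝ) ^ 6 * γ := by
          rw [sum_const, sum_const, card_univ, Fintype.card_fin, smul_smul, nsmul_eq_mul]; push_cast; ring

end Summit.PneNP.PneNP.Theorems.ChebyshevTracialDesignAllDirectionsReduction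

end
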